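import Literature.Topology.FourManifolds.Gluing
import Literature.Topology.FourManifolds.GluingProofs
import Literature.Topology.FourManifolds.BoundaryGluingData
import Literature.Topology.FourManifolds.BoundaryManifoldHomologyVanishing
import Literature.Topology.FourManifolds.ContractibleOfConnectedBoundary
import Literature.Topology.FourManifolds.SphereSimplyConnected
import Literature.Topology.FourManifolds.HomotopyS4CompactProofs
import Literature.AlgebraicTopology.SingularHomology.ExcisionMayerVietorisProofs
import Literature.AlgebraicTopology.SingularHomology.RelFundamentalClassModTwo
import Literature.AlgebraicTopology.SingularHomology.UniversalCoefficientsField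
import Literature.Barriers.SmoothPoincare4.ExoticContractibleSymmetryKillingCore
import Mathlib.AlgebraicTopology.FundamentalGroupoid.SimplyConnected
import Mathlib.Algebra.Field.ZMod
import HarnessLib

/-!
# Stub `stub_doubleHalfContractible` of line `exchange-recognition`
# for crux `ConvexBisection.AcyclicBisectionRigidity`
(item stmt-SmoothPoincare4-10507, route route-SmoothPoincare4-ConvexBisection)

The **double sector** of the crux: if a double `P = W ∪_{id} W` (`IsDouble b (𝓡 4) P`) of a
compact smooth `4`-manifold with boundary `W` is a homotopy `4`-sphere, then `W` is
CONTRACTIBLE (no Stein structure and, as it turns out, no rational acyclicity is needed: the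
hypothesis `hac` of the registered signature is carried but not used).

Proof.  (1) Gluing data `G` of the double (`IsBoundaryGluing.nonempty_boundaryGluingData`) and
the fold retraction `r : P → W`, `r ∘ jA = id` (`BoundaryGluingData.exists_retraction_of_refl`).
(2) `P ≃ₕ S⁴` is path connected and simply connected (`π₁(S⁴) = 1`,
`simplyConnectedSpace_sphere_four_holds`), hence so is its retract `W`
(`simplyConnectedSpace_of_leftInverse`).  (3) `jA_* : H_k(W) ↪ H_k(P) ≅ H_k(S⁴) = 0` for
`k = 1, 2, 3` and all coefficients (`isZero_singularHomology_of_retract`).  (4) `∂W ≠ ∅`: otherwise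
the two copies `jA(W)`, `jB(W)` are disjoint nonempty closed sets covering the connected `P`.
(5) `∂W` is connected: `H₃(W; ℤ/2) = 0` gives `H³(W; ℤ/2) = 0` (universal coefficients over a
field), so `H₁(W, ∂W; ℤ/2) ≅ H³(W; ℤ/2) = 0` by mod-2 Lefschetz duality
(`bijective_relCapProduct_relFundamentalClassModTwo`), so `H₀(∂W; ℤ/2) → H₀(W; ℤ/2) ≅ ℤ/2` is
injective (exact sequence of the pair) and the locally path-connected `∂W` is path connected
(`pathConnectedSpace_of_forall_singularHomology_zero_eq`).  (6) The tree's recognition theorem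
`contractibleSpace_of_isZero_singularHomology_of_boundary_connected` (`m = 2`: compact simply
connected `4`-manifold with connected nonempty boundary and `H₁ = H₂ = 0` is contractible —
Lefschetz duality, Hurewicz, Whitehead) concludes.
-/

noncomputable section

-- the prescribed namespace `Summit.<P>.<Sub>.…` duplicates `SmoothPoincare4` (P = Sub)
set_option linter.dupNamespace false

open scoped Manifold ContDiff Topology ContinuousMap
open Set Function CategoryTheory CategoryTheory.Limits
open Literature.AlgebraicTopology.SingularHomology Literature.Topology.FourManifolds

namespace Summit.SmoothPoincare4.SmoothPoincare4.Theorems.AcyclicBisectionRigidity.ExchangeRecognition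

/-- Local notation (that of the registered skeleton): the round 4-sphere with its Mathlib manifold
structure. -/
local notation "𝕊⁴" => (Metric.sphere (0 : EuclideanSpace ℝ (Fin 5)) 1)

/-- Local notation (that of the registered skeleton): the model space `ℝ⁴`. -/
local notation "E4" => EuclideanSpace ℝ (Fin 4)

/-! ### Retracts of simply connected spaces and of homotopy spheres -/

/-- **A retract of a simply connected space is simply connected**: if `r ∘ i = id` with
`i : X → Y`, `r : Y → X` continuous and `Y` simply connected, then `X` (nonempty) is path
connected (`r` is onto) and two paths `p₁, p₂ : x ⇝ y` in `X` are homotopic, being the images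
under `r` of the homotopic paths `i ∘ p₁`, `i ∘ p₂` of `Y` (Hatcher 2002, Prop. 1.17 / Ex. 1.1.11:
a retraction induces a surjection on `π₁` split by `i_*`). [cite: HatcherAT2002, Prop. 1.17] -/
private theorem simplyConnectedSpace_of_leftInverse {X Y : Type*} [TopologicalSpace X]
    [TopologicalSpace Y] [SimplyConnectedSpace Y] [Nonempty X]
    (i : C(X, Y)) (r : C(Y, X)) (h : ∀ x, r (i x) = x) : SimplyConnectedSpace X := by
  haveI : PathConnectedSpace X := by
    have hsurj : Function.Surjective r := fun x => ⟨i x, h x⟩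
    rw [pathConnectedSpace_iff_univ, ← hsurj.range_eq]
    exact isPathConnected_range r.continuous
  refine simply_connected_iff_paths_homotopic'.2 ⟨‹_›, ?_⟩
  intro x y p₁ p₂
  obtain ⟨H⟩ := (SimplyConnectedSpace.paths_homotopic (p₁.map i.continuous)
    (p₂.map i.continuous)).map r
  have e : ∀ p : Path x y,
      ((p.map i.continuous).map r.continuous).toContinuousMap = p.toContinuousMap :=
    fun p => by ext t; exact h (p t)
  change ((p₁.map i.continuous).map r.continuous).toContinuousMap.HomotopyRel
    ((p₂.map i.continuous).map r.continuous).toContinuousMap {0, 1} at H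
  rw [e p₁, e p₂] at H
  exact ⟨H⟩

/-- **The homology of a retract of a homotopy `4`-sphere vanishes in degrees `k ≠ 0, 4`**, for
all coefficients: `r ∘ i = id` makes `i_* : H_k(W) → H_k(P)` injective, and
`H_k(P) ≅ H_k(S⁴) = 0` (homotopy invariance, Hatcher Cor. 2.11, and Cor. 2.14).
[cite: HatcherAT2002, Cor. 2.11 and Cor. 2.14] -/
private theorem isZero_singularHomology_of_retract {W P : Type} [TopologicalSpace W]
    [TopologicalSpace P] (hP : P ≃ₕ 𝕊⁴) (i : C(W, P)) (r : C(P, W)) (h : ∀ x, r (i x) = x)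
    (R : Type) [CommRing R] (M : Type) [AddCommGroup M] [Module R M] {k : ℕ} (hk : k ≠ 0)
    (hk4 : k ≠ 4) : IsZero (singularHomology R M W k) := by
  have hP0 : IsZero (singularHomology R M P k) :=
    (isZero_singularHomology_sphere_holds R M hk hk4).of_iso
      (singularHomology.isoOfHomotopyEquiv R M hP k)
  have hcomp : r.comp i = ContinuousMap.id W := by
    ext a
    exact h a
  haveI : Mono (singularHomology.map R M i k) := by
    refine ⟨fun f g hfg => ?_⟩
    have := congrArg (· ≫ singularHomology.map R M r k) hfg
    simpa only [Category.assoc, ← singularHomology.map_comp, hcomp, singularHomology.map_id,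
      Category.comp_id] using this
  exact hP0.of_mono (singularHomology.map R M i k)

/-! ### The boundary of a compact `4`-manifold with `H₃(W; ℤ/2) = 0` is connected -/

/-- **If `W` is a compact path-connected `4`-manifold with boundary and `H₃(W; ℤ/2) = 0`, then
every nonempty boundary datum of `W` is path connected.**  `H³(W; ℤ/2) ≅ Hom(H₃(W; ℤ/2), ℤ/2) = 0`
(universal coefficients over a field, Hatcher Thm. 3.2 / p. 198), so
`H₁(W, ∂W; ℤ/2) ≅ H³(W; ℤ/2) = 0` by Lefschetz duality mod 2 (Hatcher Thm. 3.43, valid for every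
compact manifold with boundary), so `H₀(∂W; ℤ/2) → H₀(W; ℤ/2) ≅ ℤ/2` is injective (exact sequence
of the pair, Thm. 2.16) and the locally path-connected `∂W` has a single path component
(Prop. 2.6–2.7).
[cite: HatcherAT2002, Thm. 3.43, Thm. 3.2 (p. 198), Thm. 2.16, Prop. 2.7] -/
private theorem pathConnectedSpace_boundaryCarrier {W : Type} [TopologicalSpace W] [T2Space W]
    [CompactSpace W] [ChartedSpace (EuclideanHalfSpace 4) W] [PathConnectedSpace W]
    (h3 : IsZero (singularHomology (ZMod 2) (ZMod 2) W 3))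
    (b : BoundaryData (𝓡∂ 4) W (𝓡 3)) [Nonempty b.carrier] : PathConnectedSpace b.carrier := by
  set B : Set W := (𝓡∂ 4).boundary W with hB
  -- `H³(W; ℤ/2) = 0`
  have hcoh : IsZero (singularCohomology (ZMod 2) (ZMod 2) W 3) := by
    haveI := ModuleCat.subsingleton_of_isZero h3
    haveI : Subsingleton (singularHomology (ZMod 2) (ZMod 2) W 3 →ₗ[ZMod 2] ZMod 2) :=
      ⟨fun f g => LinearMap.ext fun x => by rw [Subsingleton.elim x 0, map_zero, map_zero]⟩
    haveI : Subsingleton (singularCohomology (ZMod 2) (ZMod 2) W 3) :=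
      (kroneckerPairing_bijective_of_field (ZMod 2) W 3).1.subsingleton
    exact ModuleCat.isZero_of_subsingleton _
  -- `H₁(W, ∂W; ℤ/2) = 0` by Lefschetz duality mod 2
  have hrel : IsZero (relativeSingularHomology (ZMod 2) (ZMod 2) W B (0 + 1)) := by
    have hpq : 3 + (0 + 1) = 3 + 1 := rfl
    have hbij := bijective_relCapProduct_relFundamentalClassModTwo (n := 3) (W := W) hpq
    haveI : Subsingleton (singularCohomology (ZMod 2) (ZMod 2) W 3) :=
      ModuleCat.subsingleton_of_isZero hcoh
    haveI : Subsingleton (relativeSingularHomology (ZMod 2) (ZMod 2) W B (0 + 1)) := by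
      refine ⟨fun z z' => ?_⟩
      obtain ⟨a, rfl⟩ := hbij.2 z
      obtain ⟨a', rfl⟩ := hbij.2 z'
      rw [Subsingleton.elim a a']
    exact ModuleCat.isZero_of_subsingleton _
  -- `H₀(∂W; ℤ/2) → H₀(W; ℤ/2)` is injective
  have hmono : Mono (singularHomology.map (ZMod 2) (ZMod 2) (subsetIncl B) 0) :=
    (relativeSingularHomology.exact_δ_map (ZMod 2) (ZMod 2) B 0).mono_g (hrel.eq_of_src _ _)
  -- the boundary datum as the composite of a homeomorphism onto `∂W` and the inclusion
  let eB : b.carrier ≃ₜ ↥B :=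
    b.isSmoothEmbedding.isEmbedding.toHomeomorph.trans (Homeomorph.setCongr b.range_incl)
  let ι : C(b.carrier, W) := ⟨b.incl, b.continuous_incl⟩
  have hfac : ι = (subsetIncl B).comp (eB : C(b.carrier, ↥B)) := by
    ext x
    exact (b.isSmoothEmbedding.isEmbedding.toHomeomorph_apply_coe x).symm
  haveI hmonoι : Mono (singularHomology.map (ZMod 2) (ZMod 2) ι 0) := by
    rw [hfac, singularHomology.map_comp]
    haveI : IsIso (singularHomology.map (ZMod 2) (ZMod 2) (eB : C(b.carrier, ↥B)) 0) :=
      (singularHomology.mapIso (ZMod 2) (ZMod 2) eB 0).isIso_hom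
    infer_instance
  have hinj : Function.Injective (singularHomology.map (ZMod 2) (ZMod 2) ι 0) :=
    (ModuleCat.mono_iff_injective _).mp inferInstance
  -- `∂W` is locally path connected, hence path connected
  haveI : LocallyPathConnectedSpace b.carrier :=
    ChartedSpace.locallyPathConnectedSpace (EuclideanSpace ℝ (Fin 3)) b.carrier
  refine Literature.Barriers.SmoothPoincare4.pathConnectedSpace_of_forall_singularHomology_zero_eq
    fun x y hx hy => hinj ?_
  refine Literature.Barriers.SmoothPoincare4.singularHomology_zero_eq_of_ne_zero
    (fun h0 => hx (hinj ?_)) (fun h0 => hy (hinj ?_))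
  · rw [h0, map_zero]
  · rw [h0, map_zero]

/-! ### The stub -/

set_option linter.unusedVariables false in
/-- **Stub `stub_doubleHalfContractible` (a homotopy-sphere double has a contractible half).**
If `W` is a compact smooth `4`-manifold with boundary (Hausdorff, second countable; rationally
acyclic in positive degrees — not used) and some double `P = W ∪_{id} W` (`IsDouble b (𝓡 4) P`)
is a homotopy `4`-sphere, then `W` is contractible.  The fold map `r : P → W` retracts `P` onto
its first copy `jA(W)` (`BoundaryGluingData.exists_retraction_of_refl`), so `W` is simply
connected with `P` (`π₁(S⁴) = 1`) and `H_k(W) ↪ H_k(P) = H_k(S⁴) = 0` for `k = 1, 2, 3` (all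
coefficients); `∂W ≠ ∅` since the two copies of `W` cover the connected `P` and meet only along
`∂W`; `∂W` is connected by mod-2 Lefschetz duality (`H₁(W, ∂W; ℤ/2) ≅ H³(W; ℤ/2) = 0` and the
sequence of the pair); and a compact simply connected `4`-manifold with connected nonempty
boundary and `H₁ = H₂ = 0` is contractible
(`contractibleSpace_of_isZero_singularHomology_of_boundary_connected`: Lefschetz duality,
Hurewicz, Whitehead).  Hatcher 2002, Thm. 3.43, Thm. 4.5, Cor. 4.33; Kervaire–Milnor 1963,
p. 514. [cite: HatcherAT2002, Thm. 3.43, Thm. 4.5 and Cor. 4.33] -/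
theorem stub_doubleHalfContractible
    (W : Type) [TopologicalSpace W] [T2Space W] [SecondCountableTopology W]
    [ChartedSpace (EuclideanHalfSpace 4) W] [IsManifold (𝓡∂ 4) ∞ W] [CompactSpace W]
    (hac : ∀ k, 0 < k → IsZero (singularHomology ℚ ℚ W k))
    (b : BoundaryData (𝓡∂ 4) W (𝓡 3))
    (P : Type) [TopologicalSpace P] [T2Space P] [SecondCountableTopology P] [ChartedSpace E4 P]
    [IsManifold (𝓡 4) ∞ P] (hD : IsDouble b (𝓡 4) P) (hP : P ≃ₕ 𝕊⁴) :
    ContractibleSpace W := by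
  -- (1) gluing data of the double
  obtain ⟨G⟩ : Nonempty (BoundaryGluingData b b (Equiv.refl b.carrier) P) :=
    IsBoundaryGluing.nonempty_boundaryGluingData (φ := Equiv.refl b.carrier) hD
  -- (2) `P` is path connected and simply connected
  haveI : PathConnectedSpace P := by
    haveI := pathConnectedSpace_sphere_four
    exact pathConnectedSpace_of_homotopyEquiv hP
  haveI : SimplyConnectedSpace P := by
    haveI : SimplyConnectedSpace 𝕊⁴ := simplyConnectedSpace_sphere_four_holds
    exact hP.simplyConnectedSpace
  -- `W` is nonempty: the two copies of `W` cover the nonempty `P`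
  haveI hWne : Nonempty W := by
    obtain ⟨p⟩ := (inferInstance : Nonempty P)
    have hp : p ∈ range G.jA ∪ range G.jB := by
      rw [G.range_union]
      exact mem_univ p
    rcases hp with ⟨a, -⟩ | ⟨a, -⟩ <;> exact ⟨a⟩
  -- the fold retraction; `W` is simply connected
  obtain ⟨r, hrA, -⟩ := G.exists_retraction_of_refl
  let jA : C(W, P) := ⟨G.jA, G.continuous_jA⟩
  have hrjA : ∀ a, r (jA a) = a := hrA
  haveI : SimplyConnectedSpace W := simplyConnectedSpace_of_leftInverse jA r hrjA
  -- (3) `H₁(W; ℤ) = H₂(W; ℤ) = 0` and `H₃(W; ℤ/2) = 0`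
  have hH : ∀ q : ℕ, 1 ≤ q → q ≤ 2 → IsZero (singularHomology ℤ ℤ W q) := fun q h1 h2 =>
    isZero_singularHomology_of_retract hP jA r hrjA ℤ ℤ (by omega) (by omega)
  have h3 : IsZero (singularHomology (ZMod 2) (ZMod 2) W 3) :=
    isZero_singularHomology_of_retract hP jA r hrjA (ZMod 2) (ZMod 2) (by omega) (by omega)
  -- (4) `∂W ≠ ∅`
  have hne : ((𝓡∂ 4).boundary W).Nonempty := by
    by_contra hempty
    rw [not_nonempty_iff_eq_empty] at hempty
    have hcar : ∀ z : b.carrier, False := fun z => by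
      have hz := b.incl_mem_boundary z
      rw [hempty] at hz
      exact hz
    have hdisj : Disjoint (range G.jA) (range G.jB) := by
      rw [disjoint_iff_forall_ne]
      rintro _ ⟨a, rfl⟩ _ ⟨a', rfl⟩ h
      obtain ⟨z, -, -⟩ := (G.jA_eq_jB_iff a a').1 h
      exact hcar z
    have hclA : IsClosed (range G.jA) := (isCompact_range G.continuous_jA).isClosed
    have hclB : IsClosed (range G.jB) := (isCompact_range G.continuous_jB).isClosed
    obtain ⟨a⟩ := hWne
    have hpre : IsPreconnected (univ : Set P) := isPreconnected_univ
    rw [isPreconnected_closed_iff] at hpre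
    obtain ⟨p, -, hpA, hpB⟩ := hpre (range G.jA) (range G.jB) hclA hclB G.range_union.ge
      ⟨G.jA a, mem_univ _, mem_range_self a⟩ ⟨G.jB a, mem_univ _, mem_range_self a⟩
    exact hdisj.ne_of_mem hpA hpB rfl
  -- (5) `∂W` is connected
  haveI : Nonempty b.carrier := by
    obtain ⟨x, hx⟩ := hne
    rw [← b.range_incl] at hx
    obtain ⟨z, -⟩ := hx
    exact ⟨z⟩
  haveI : PathConnectedSpace b.carrier := pathConnectedSpace_boundaryCarrier h3 b
  have hconn : IsConnected ((𝓡∂ 4).boundary W) := by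
    rw [← b.range_incl]
    exact (isPathConnected_range b.continuous_incl).isConnected
  -- (6) recognition
  exact contractibleSpace_of_isZero_singularHomology_of_boundary_connected (m := 2) (by norm_num)
    W hne hconn hH

end Summit.SmoothPoincare4.SmoothPoincare4.Theorems.AcyclicBisectionRigidity.ExchangeRecognition

end
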